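import Summits.Ventures.CertifiedManyBodySolver.Certificates.EmeryCu4O8_kry_CCOC_c3hh_s9x10_S0
import HarnessLib

/-!
# KLDL-R certificate: an exact cluster vector of the open `Cu₄O₈` block (CCOC three-band corner `c3hh`, sector `(9,10)`, `N = 19`) — part S4 (kernel traces of atom classes [1, 3])

HONEST FRAMING: certified energy-window bookkeeping (a hypothesis-free UPPER bound on the three-band ground-state energy density at
`ρ = 19/16` from ONE explicit cluster vector, Ruelle's cluster variational principle as typed in `EmeryThreeBandBlock2x2RayleighCap`);
not a superconductivity verdict; no number of record at an anchor moves. WHAT-THIS-IS-NOT: a floor; a phase word.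

The vector: the integer-rounded (scale `2^16`) lowest eigenvector of `h(θ) = Σ_a θ_a h^G_a` (`h^G_a = hubbardOpenBoxGP 1 12 (cu4o8Tau a) (cu4o8Ups a) (cu4o8Nu a)`)
on the spin sector `(9,10)` of the twelve physical sites of the open `2×2`-cell block (dimension 14520; 5500 nonzero coefficients — TRUNCATED to the 5500 largest-modulus coefficients of the rounded eigenvector (a valid trial vector; exact Rayleigh quotient 34.932093 vs eigenvalue 34.802634 eV/cluster)), at the coupling vector
`θ = ['139/100', '139/100', '139/100', '139/100', '-69/100', '-69/100', '-69/100', '-69/100', '103/50', '0', '0', '154/25', '2619/500', '2619/500']` (CCOC corner `c3hh` of `BLOCK-TABLES-La214v123_v1` = (t_pd ×4, −t_pp ×4, Δ_pd, ε_px, ε_py, U_d, U_px, U_py), cuprate signs),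
stored as a `CoefTree` (search tree over occupation codes, `HubbardOpenBoxCodedRayleigh`). Norm `NN = 4256609058`; the fourteen EXACT integer traces
`S_a = NN·⟨unit, h^G_a unit⟩ = [-11640684614, -6411343462, -11641452068, -6426860662, 3009788278, 6087585276, 1987014102, 3017038260, 20962564609, 29957439998, 29955567495, 4661907068, 13052551574, 13050787971]` (float eigenvalue 34.802634243 eV/cluster; exact Rayleigh quotient 34.932093491; cap 2.1832558 eV/site = 8.733023 eV/CuO₂).
Parts: S0 = the tree + search-tree order / norm / particle number (kernel); S1–S6 = the fourteen traces `CoefTree.sApp` over the hop-list oracles `cu4o8ClusterF a` (kernel, `decide +kernel`);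
F = the assembled table and the consequences (`emeryEnergyDensity_le_of_cu4o8Tree`: for EVERY `θ'`, `e_Emery(θ', 19/16) ≤ (1/16)·Σ_a θ'_a·S_a/NN`; the corner number; the `hT` trace rows,
unit norm and particle number for the `T > 0` Rayleigh-family floor `le_emeryCellPressure_of_rayleighFamily` / `Downfold/EmeryThermalSeam`).
Generator: HOME/hubbard-box-p2/code/rayleigh/ (kit job ray_main.py: scipy eigsh + exact integer forms; emit_kry.py), hubbard-box-p2 g15.
[cite: Ruelle1969, §3.3] [cite: Emery1987, eq. (1)] [cite: LinGubernatis1993, §II]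
-/

noncomputable section

namespace Summit.Ventures.CertifiedManyBodySolver.Certificates

open Matrix Literature.MathematicalPhysics.QuantumLattice OccupationCode OccupationCode.CoefTree ClusterLowerBound InfVolFermionState HubbardWave0

/-- The exact trace of atom class `1` (kernel). [cite: Ruelle1969, §3.3] -/
theorem kry_CCOC_c3hh_s9x10_sApp1 : kry_CCOC_c3hh_s9x10.sApp (cu4o8ClusterF 1) = -6411343462 := by decide +kernel

/-- The exact trace of atom class `3` (kernel). [cite: Ruelle1969, §3.3] -/
theorem kry_CCOC_c3hh_s9x10_sApp3 : kry_CCOC_c3hh_s9x10.sApp (cu4o8ClusterF 3) = -6426860662 := by decide +kernel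

end Summit.Ventures.CertifiedManyBodySolver.Certificates

end
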